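import Mathlib
import Summits.ResolutionOfSingularities.ResolutionOfSingularities.Theorems.HomologicalConductorPersistenceSurfacePlateauLocal
import Summits.ResolutionOfSingularities.ResolutionOfSingularities.Theorems.HomologicalConductorPersistenceKC3LocIsLocalization
import Literature.RingTheory.CohomologyAnnihilator.CompletionTheorem
import HarnessLib

/-!
# Rung S-2 `PersistenceSurface` (stmt-ResolutionOfSingularities-19970) — the PLATEAU KILL TEMPLATE:
# a stage whose completion is the `A_n` model loses every element that becomes `unit · z^a`, `a < ⌈n/2⌉`

Route `ResolutionOfSingularities/HomologicalConductor` (cell decomp-res, hand leafhand-res-homologicalconduct-23 g0).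
OURS: AI-written, weaker than expert review; nothing here is a statement of the manuscript under review (Hironaka 2017);
no crux, kill test or summit statement is proved.  SUPPORT level, def-free, fact-free (the Bahlekeh–Hakimian–Salarian–
Takahashi completion theorem is the tree's PROVED `Literature.RingTheory.CohomologyAnnihilator.le_caCompletion_comap_holds`).

THE TEMPLATE (memo `HAND23-PLATEAU-DICHOTOMY.md` v2, §1 «consumer path»).  Let `T` be a noetherian local ring of Krull dimension
`d` (a tower stage `T_1 = O_{X',P}`), `T̂` its `𝔪`-adic completion, assumed an isolated singularity, and suppose `T̂` is a FLAT
`Λ_n`-algebra (`Λ_n = k[u,w,z]/(uw − z^{n+1})`; e.g. `T̂ ≅ k[[u,w,z]]/(uw − z^{n+1})`, an `A_n` point) that still maps to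
`k[X]/(X^{n+1})` with `u, w ↦ 0`, `z ↦ X`.  If `x ∈ T` becomes `ε · z^a` in `T̂` with `ε` a unit and `a < (n+1)/2 = ⌈n/2⌉`, then
**`x ∉ ca(T)`**: `x ∈ caˢ(T) ⇒ x ∈ caˢ⁺ᵈ(T̂)` (BHST 2015, Thm 4.5 (2)) `⇒ z^a ∈ caˢ⁺ᵈ(T̂)` (an ideal) — against
`An_pow_not_mem_cohomologyAnnihilatorOfDegree_baseChange`.

* `not_mem_cohomologyAnnihilator_of_completion_An_model` — the template for an abstract local ring `T`;
* `not_mem_ca_of_completion_An_model` — the same for a STAGE `B : Subalgebra k' K'` in the route's vocabulary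
  (`x ∉ NoZeno.Birth.ca B`, via `PersistenceKC3Loc.not_mem_ca_of_not_mem_cohomologyAnnihilator`).

With `…PersistenceSurfaceFirstStep` this is the complete Lean vehicle of a plateau refutation of `PersistenceSurface`; what a
consumer must still supply is ARITHMETIC-GEOMETRIC: a stage `B` with a low plateau (memo §2 (PL); kit spec §4: long-chain
cusps), and for its `A_{n}` point `P` the presentation of `Ô_{X',P}` as a flat `Λ_n`-algebra with `x ↦ ε z^a`.

References: A. Bahlekeh, E. Hakimian, S. Salarian, R. Takahashi, *Annihilation of cohomology, generation of modules and
finiteness of derived dimension*, Q. J. Math. (2015), Thm 4.5 [`BahlekehHakimianSalarianTakahashi2015`] — used through the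
tree's proof; S. B. Iyengar, R. Takahashi, IMRN 2016, Lemma 2.14 [`IyengarTakahashi2014`].
-/

noncomputable section

-- single-problem summit: the doubled namespace component `ResolutionOfSingularities` is forced
set_option linter.dupNamespace false

open CategoryTheory Literature.RingTheory.CohomologyAnnihilator IsLocalRing
open Literature.AlgebraicGeometry.Resolution (isNoetherianRing_adicCompletion_maximalIdeal)
open Summit.ResolutionOfSingularities.ResolutionOfSingularities.Theorems.HomologicalConductor.PersistenceKC3Loc

universe u

namespace Summit.ResolutionOfSingularities.ResolutionOfSingularities.Theorems.HomologicalConductor.PersistenceSurfacePlateauCertificate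

section ModelAn

open MvPolynomial

variable (k : Type u) [Field k] (n : ℕ)

/-- The `A_n` coordinate ring `Λ_n = k[X₀,X₁,X₂]/(X₀X₁ − X₂^{n+1})` (local notation only). -/
local notation3 "Λ_[" k ", " n "]" =>
  MvPolynomial (Fin 3) k ⧸ Ideal.span {(X 0 * X 1 - X 2 ^ (n + 1) : MvPolynomial (Fin 3) k)}
/-- The quotient map `k[X₀,X₁,X₂] → Λ_n` (local notation only). -/
local notation3 "π_[" k ", " n "]" =>
  Ideal.Quotient.mk (Ideal.span {(X 0 * X 1 - X 2 ^ (n + 1) : MvPolynomial (Fin 3) k)})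

/-- **Plateau kill template (abstract local ring).**  `T` noetherian local of Krull dimension `d` with `T̂` an isolated
singularity and a flat `Λ_n`-algebra mapping to `k[X]/(X^{n+1})` (`u, w ↦ 0`, `z ↦ X`); if `x ∈ T` becomes `ε · z^a` in `T̂`,
`ε` a unit, `a < (n+1)/2`, then `x ∉ ca(T)`. [this work; cite: BahlekehHakimianSalarianTakahashi2015, Theorem 4.5 (2)] -/
theorem not_mem_cohomologyAnnihilator_of_completion_An_model (T : Type u) [CommRing T] [IsNoetherianRing T]
    [IsLocalRing T] {d : ℕ} (hd : ringKrullDim T = d)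
    (hiso : IsIsolatedSingularity (AdicCompletion (maximalIdeal T) T))
    [Algebra Λ_[k, n] (AdicCompletion (maximalIdeal T) T)] [Module.Flat Λ_[k, n] (AdicCompletion (maximalIdeal T) T)]
    (Φ' : AdicCompletion (maximalIdeal T) T →+* Polynomial k ⧸ Ideal.span {(Polynomial.X : Polynomial k) ^ (n + 1)})
    (h0 : Φ' (algebraMap Λ_[k, n] _ (π_[k, n] (X 0))) = 0)
    (h1 : Φ' (algebraMap Λ_[k, n] _ (π_[k, n] (X 1))) = 0)
    (h2 : Φ' (algebraMap Λ_[k, n] _ (π_[k, n] (X 2))) = Ideal.Quotient.mk _ Polynomial.X)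
    (x : T) (ε : AdicCompletion (maximalIdeal T) T) (hε : IsUnit ε) (a : ℕ) (ha : a < (n + 1) / 2)
    (hx : algebraMap T (AdicCompletion (maximalIdeal T) T) x =
      ε * algebraMap Λ_[k, n] (AdicCompletion (maximalIdeal T) T) (π_[k, n] (X 2)) ^ a) :
    x ∉ cohomologyAnnihilator T := by
  haveI : IsNoetherianRing (AdicCompletion (maximalIdeal T) T) := isNoetherianRing_adicCompletion_maximalIdeal T
  rw [mem_cohomologyAnnihilator_iff]
  rintro ⟨s, hs⟩
  -- BHST 4.5 (2): `x ∈ caˢ⁺ᵈ(T̂)`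
  have hx' := le_caCompletion_comap_holds T d hd hiso s hs
  rw [Ideal.mem_comap, hx] at hx'
  -- divide by the unit `ε`
  obtain ⟨e, he⟩ := hε.exists_left_inv
  have hz : algebraMap Λ_[k, n] (AdicCompletion (maximalIdeal T) T) (π_[k, n] (X 2)) ^ a ∈
      cohomologyAnnihilatorOfDegree (AdicCompletion (maximalIdeal T) T) (s + d) := by
    have := Ideal.mul_mem_left _ e hx'
    rwa [← mul_assoc, he, one_mul] at this
  exact An_pow_not_mem_cohomologyAnnihilatorOfDegree_baseChange k n (AdicCompletion (maximalIdeal T) T) Φ' h0 h1 h2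
    a ha (s + d) hz

/-- **Plateau kill template (stage form).**  For a stage `B : Subalgebra k' K'` of the canonical tower (a local noetherian
ring of Krull dimension `d` whose completion is an isolated singularity presented as a flat `Λ_n`-algebra as above) and
`x ∈ B` with `x ↦ ε · z^a` in `B̂`, `a < (n+1)/2`: **`x ∉ ca B`** in the route's vocabulary `NoZeno.Birth.ca`.  (The
consumer `B = T_1 = loc O (nrm (chart O T_0))` with `x ∈ ca T_0` then contradicts first-step persistence,
`…PersistenceSurfaceFirstStep`.) [this work; cite: BahlekehHakimianSalarianTakahashi2015, Theorem 4.5 (2)] -/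
theorem not_mem_ca_of_completion_An_model {k' K' : Type} [Field k'] [Field K'] [Algebra k' K'] (B : Subalgebra k' K')
    [IsNoetherianRing ↥B] [IsLocalRing ↥B] {d : ℕ} (hd : ringKrullDim ↥B = d)
    (hiso : IsIsolatedSingularity (AdicCompletion (maximalIdeal ↥B) ↥B))
    {k : Type} [Field k] (n : ℕ)
    [Algebra (MvPolynomial (Fin 3) k ⧸ Ideal.span {(X 0 * X 1 - X 2 ^ (n + 1) : MvPolynomial (Fin 3) k)})
      (AdicCompletion (maximalIdeal ↥B) ↥B)]
    [Module.Flat (MvPolynomial (Fin 3) k ⧸ Ideal.span {(X 0 * X 1 - X 2 ^ (n + 1) : MvPolynomial (Fin 3) k)})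
      (AdicCompletion (maximalIdeal ↥B) ↥B)]
    (Φ' : AdicCompletion (maximalIdeal ↥B) ↥B →+* Polynomial k ⧸ Ideal.span {(Polynomial.X : Polynomial k) ^ (n + 1)})
    (h0 : Φ' (algebraMap (MvPolynomial (Fin 3) k ⧸ Ideal.span {(X 0 * X 1 - X 2 ^ (n + 1) : MvPolynomial (Fin 3) k)}) _
      (Ideal.Quotient.mk _ (X 0))) = 0)
    (h1 : Φ' (algebraMap (MvPolynomial (Fin 3) k ⧸ Ideal.span {(X 0 * X 1 - X 2 ^ (n + 1) : MvPolynomial (Fin 3) k)}) _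
      (Ideal.Quotient.mk _ (X 1))) = 0)
    (h2 : Φ' (algebraMap (MvPolynomial (Fin 3) k ⧸ Ideal.span {(X 0 * X 1 - X 2 ^ (n + 1) : MvPolynomial (Fin 3) k)}) _
      (Ideal.Quotient.mk _ (X 2))) = Ideal.Quotient.mk _ Polynomial.X)
    {x : K'} (hxB : x ∈ B) (ε : AdicCompletion (maximalIdeal ↥B) ↥B) (hε : IsUnit ε) (a : ℕ) (ha : a < (n + 1) / 2)
    (hx : algebraMap ↥B (AdicCompletion (maximalIdeal ↥B) ↥B) ⟨x, hxB⟩ =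
      ε * algebraMap (MvPolynomial (Fin 3) k ⧸ Ideal.span {(X 0 * X 1 - X 2 ^ (n + 1) : MvPolynomial (Fin 3) k)})
        (AdicCompletion (maximalIdeal ↥B) ↥B) (Ideal.Quotient.mk _ (X 2)) ^ a) :
    x ∉ NoZeno.Birth.ca B :=
  not_mem_ca_of_not_mem_cohomologyAnnihilator B hxB
    (not_mem_cohomologyAnnihilator_of_completion_An_model k n ↥B hd hiso Φ' h0 h1 h2 ⟨x, hxB⟩ ε hε a ha hx)

end ModelAn

end Summit.ResolutionOfSingularities.ResolutionOfSingularities.Theorems.HomologicalConductor.PersistenceSurfacePlateauCertificate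

end
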